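import Summits.CriticalPhenomena.PercolationContinuityZ3.Theorems.PercNearOneGluingNoHeavyLowerTailSunflowerMultiPetalPendant
import HarnessLib
import HarnessLib.Audit

/-!
# `NoHeavyLowerTail` (crux stmt-CriticalPhenomena-4575), abstract sunflower cubic, `k` petals: the INJECTIVELY COLOURED CLUTTER structure
# `MSunflower.ofClutter E` of a family of sets `E : Fin k → Finset α`, and ★ₖ for every family with a LEAF ELIMINATION ORDER — in particular
# for the edge sets of all FORESTS (every size, every number of petals)

Support file (seat `prim-l12-p2` gen 35; `--supports stmt-CriticalPhenomena-4575`; companion of `…SunflowerMultiPetalPendant` (this gen: pendant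
identity / inequality, `MSunflower.ZK_nonneg_of_pendantOrder`)).  Everything here is PROVED; nothing is asserted about the crux; no `sorry`.
Memo: run/shared/lean/prim/prim-l12/prim-l12-p2/FINDING-g35-GRAPH-PENCIL.md §2.

SETTING.  A family `E : Fin k → Finset α` ("edges", colour = index) defines the monotone map `2^α → M_k`:  `S ↦ ⊤` if `S` contains two edges of
different colours, `S ↦` petal `i` if the edges inside `S` are exactly those of colour `i` (at least one), `S ↦ 0` if `S` contains no edge
(`MSunflower.ofClutter`; for an injective family of the edges of a graph this is the 'T2C' structure of the gen-34 memo §6: bottom = independent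
sets, petal `h` = vertex sets spanning exactly the edge `h`, top = vertex sets spanning ≥ 2 edges — a PRIME, SATURATED structure in general).

* `MSunflower.ofClutter`, `mem_ofClutter_A`, `mem_ofClutter_V`, `ofClutter_lab_eq_of_forall` (the label of `S` depends only on which edges lie in `S`).
* `MSunflower.ofClutter_actsThrough` — if every edge through `e` inside the window `insert e W` contains `u ≠ e`, then `e` acts through `u` on `W`
  (`lab (insert e X) = lab X` for `X ⊆ W`, `u ∉ X`); `ofClutter_lab_pair_ne_zero` — an edge inside `{e,u}` makes `{e,u}` non-bottom.
* `MSunflower.ZK_nonneg_ofClutter_of_leafOrder` — **★ₖ for families with a leaf elimination order** (this work): if every nonempty `W ⊆ α` has a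
  point `e ∈ W` such that EITHER no edge through `e` lies inside `W` (isolated) OR some `u ∈ W`, `u ≠ e`, lies on every edge through `e` inside `W`
  and some edge lies inside `{e,u}` (leaf), then `0 ≤ ZK (ofClutter E)`.  For the edge family of a finite simple GRAPH the hypothesis says that every
  induced subgraph has a vertex of degree ≤ 1, i.e. that the graph is a FOREST: **★ₖ holds for the coloured clutters of all forests** (previously:
  ≤ 5 points by `…MultiPetalLeFive`; stars and matchings by the module theorems).  The proof is `ZK_nonneg_of_pendantOrder` (pendant identity
  `Z(W+e) = 2Z(W) + Z(W/e)`, exact at a leaf, plus (MZₖ) at the non-bottom singleton `{u}` of the contraction).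
-/

namespace Summit.CriticalPhenomena.PercolationContinuityZ3.Theorems.SunflowerPartition

open Finset

variable {α : Type*} [DecidableEq α] [Fintype α] {k : ℕ}

namespace MSunflower

/-- **The injectively coloured clutter structure** of a family of sets `E : Fin k → Finset α`: kernel = sets containing two edges of different
colours, petal `i` = sets containing the edge `E i` (or in the kernel). [this work] -/
def ofClutter (E : Fin k → Finset α) : MSunflower k α where
  V i := univ.filter fun S => E i ⊆ S ∨ ∃ a b : Fin k, a ≠ b ∧ E a ⊆ S ∧ E b ⊆ S
  A := univ.filter fun S => ∃ a b : Fin k, a ≠ b ∧ E a ⊆ S ∧ E b ⊆ S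
  upperV := by
    intro i S T hST hS
    have hS' := (mem_filter.1 hS).2
    refine mem_filter.2 ⟨mem_univ _, ?_⟩
    rcases hS' with h | ⟨a, b, hab, ha, hb⟩
    · exact Or.inl (h.trans hST)
    · exact Or.inr ⟨a, b, hab, ha.trans hST, hb.trans hST⟩
  upperA := by
    intro S T hST hS
    obtain ⟨a, b, hab, ha, hb⟩ := (mem_filter.1 hS).2
    exact mem_filter.2 ⟨mem_univ _, a, b, hab, ha.trans hST, hb.trans hST⟩
  A_sub := by
    intro i S hS
    exact mem_filter.2 ⟨mem_univ _, Or.inr (mem_filter.1 hS).2⟩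
  inter_sub := by
    intro i j hij S hS
    rw [mem_inter, mem_filter, mem_filter] at hS
    refine mem_filter.2 ⟨mem_univ _, ?_⟩
    rcases hS.1.2 with hi | hA
    · rcases hS.2.2 with hj | hA
      · exact ⟨i, j, hij, hi, hj⟩
      · exact hA
    · exact hA

variable (E : Fin k → Finset α)

/-- Membership in the kernel of the clutter structure. [this work] -/
theorem mem_ofClutter_A {S : Finset α} : S ∈ (ofClutter E).A ↔ ∃ a b : Fin k, a ≠ b ∧ E a ⊆ S ∧ E b ⊆ S := by
  show S ∈ univ.filter (fun S => ∃ a b : Fin k, a ≠ b ∧ E a ⊆ S ∧ E b ⊆ S) ↔ _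
  rw [mem_filter]
  exact ⟨fun h => h.2, fun h => ⟨mem_univ _, h⟩⟩

/-- Membership in a petal up-set of the clutter structure. [this work] -/
theorem mem_ofClutter_V {S : Finset α} {i : Fin k} :
    S ∈ (ofClutter E).V i ↔ E i ⊆ S ∨ ∃ a b : Fin k, a ≠ b ∧ E a ⊆ S ∧ E b ⊆ S := by
  show S ∈ univ.filter (fun S => E i ⊆ S ∨ ∃ a b : Fin k, a ≠ b ∧ E a ⊆ S ∧ E b ⊆ S) ↔ _
  rw [mem_filter]
  exact ⟨fun h => h.2, fun h => ⟨mem_univ _, h⟩⟩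

/-- The label of a set depends only on which edges it contains. [this work] -/
theorem ofClutter_lab_eq_of_forall {S T : Finset α} (h : ∀ i, E i ⊆ S ↔ E i ⊆ T) :
    (ofClutter E).lab S = (ofClutter E).lab T := by
  have hA : S ∈ (ofClutter E).A ↔ T ∈ (ofClutter E).A := by
    rw [mem_ofClutter_A, mem_ofClutter_A]
    constructor
    · rintro ⟨a, b, hab, ha, hb⟩; exact ⟨a, b, hab, (h a).1 ha, (h b).1 hb⟩
    · rintro ⟨a, b, hab, ha, hb⟩; exact ⟨a, b, hab, (h a).2 ha, (h b).2 hb⟩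
  have hV : ∀ i, S ∈ (ofClutter E).V i ↔ T ∈ (ofClutter E).V i := by
    intro i
    rw [mem_ofClutter_V, mem_ofClutter_V, h i]
    rw [mem_ofClutter_A, mem_ofClutter_A] at hA
    rw [hA]
  rcases (ofClutter E).lab_cases S with hS | hS | ⟨i, hSA, hSi, hS⟩
  · rw [((ofClutter E).lab_eq_last_iff S).2 hS, ((ofClutter E).lab_eq_last_iff T).2 (hA.1 hS)]
  · have hT : (ofClutter E).lab T = 0 := by
      rw [lab_eq_zero_iff] at hS ⊢
      exact ⟨fun hT => hS.1 (hA.2 hT), fun i hT => hS.2 i ((hV i).2 hT)⟩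
    rw [hS, hT]
  · rw [hS, (ofClutter E).lab_eq_petalLab (fun hT => hSA (hA.2 hT)) ((hV i).1 hSi)]

/-- **Leaves act through their neighbour** (this work): if `u ≠ e` lies on every edge through `e` inside `insert e W`, then `e` acts through `u`
on `W`: `lab (insert e X) = lab X` for every `X ⊆ W` with `u ∉ X`. [this work] -/
theorem ofClutter_actsThrough (W : Finset α) (e u : α) (hue : u ≠ e)
    (hW : ∀ i, e ∈ E i → E i ⊆ insert e W → u ∈ E i) :
    ∀ X : Finset α, X ⊆ W → u ∉ X → (ofClutter E).lab (insert e X) = (ofClutter E).lab X := by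
  intro X hXW huX
  refine ofClutter_lab_eq_of_forall E fun i => ⟨fun hi => ?_, fun hi => hi.trans (subset_insert e X)⟩
  by_cases hei : e ∈ E i
  · exfalso
    have hu : u ∈ E i := hW i hei (hi.trans (insert_subset_insert e hXW))
    have hu' := hi hu
    rw [mem_insert] at hu'
    rcases hu' with h | h
    · exact hue h
    · exact huX h
  · intro x hx
    have hx' := hi hx
    rw [mem_insert] at hx'
    rcases hx' with h | h
    · exact absurd (h ▸ hx) hei
    · exact h

/-- An isolated point acts through itself (is inert): if no edge through `e` lies inside `insert e W`, then `lab (insert e X) = lab X`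
for every `X ⊆ W`. [this work] -/
theorem ofClutter_inert (W : Finset α) (e : α) (hW : ∀ i, e ∈ E i → ¬ E i ⊆ insert e W) :
    ∀ X : Finset α, X ⊆ W → (ofClutter E).lab (insert e X) = (ofClutter E).lab X := by
  intro X hXW
  refine ofClutter_lab_eq_of_forall E fun i => ⟨fun hi => ?_, fun hi => hi.trans (subset_insert e X)⟩
  by_cases hei : e ∈ E i
  · exact absurd (hi.trans (insert_subset_insert e hXW)) (hW i hei)
  · intro x hx
    have hx' := hi hx
    rw [mem_insert] at hx'
    rcases hx' with h | h
    · exact absurd (h ▸ hx) hei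
    · exact h

/-- An edge inside `{e,u}` makes the pair a non-bottom set: `lab (insert e {u}) ≠ 0`. [this work] -/
theorem ofClutter_lab_pair_ne_zero (e u : α) (i : Fin k) (hi : E i ⊆ insert e {u}) :
    (ofClutter E).lab (insert e {u}) ≠ 0 := by
  intro h
  rw [lab_eq_zero_iff] at h
  exact h.2 i ((mem_ofClutter_V E).2 (Or.inl hi))

/-- **★ₖ FOR FAMILIES WITH A LEAF ELIMINATION ORDER — in particular for the edge sets of all FORESTS** (this work).  If every nonempty `W` has a
point `e ∈ W` which is ISOLATED in `W` (no edge through `e` inside `W`) or a LEAF in `W` (some `u ∈ W`, `u ≠ e`, lies on every edge through `e`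
inside `W`, and some edge lies inside `{e,u}`), then the partition functional of the clutter structure is nonnegative. [this work] -/
theorem ZK_nonneg_ofClutter_of_leafOrder
    (hleaf : ∀ W : Finset α, W.Nonempty → ∃ e ∈ W,
      (∀ i, e ∈ E i → ¬ E i ⊆ W) ∨
        ∃ u ∈ W, u ≠ e ∧ (∀ i, e ∈ E i → E i ⊆ W → u ∈ E i) ∧ ∃ i, E i ⊆ insert e {u}) :
    0 ≤ (ofClutter E).ZK := by
  refine (ofClutter E).ZK_nonneg_of_pendantOrder fun W hW => ?_
  obtain ⟨e, heW, h⟩ := hleaf W hW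
  have hWe : insert e (W.erase e) = W := insert_erase heW
  rcases h with hiso | ⟨u, huW, hue, hthrough, i, hi⟩
  · refine ⟨e, heW, e, fun X hX _ => ofClutter_inert E (W.erase e) e (fun j hj => ?_) X hX, Or.inl rfl⟩
    rw [hWe]
    exact hiso j hj
  · refine ⟨e, heW, u, ofClutter_actsThrough E (W.erase e) e u hue (fun j hj hjW => hthrough j hj ?_), Or.inr ⟨?_, ?_⟩⟩
    · rw [hWe] at hjW
      exact hjW
    · exact mem_erase.2 ⟨hue, huW⟩
    · exact ofClutter_lab_pair_ne_zero E e u i hi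

end MSunflower

end Summit.CriticalPhenomena.PercolationContinuityZ3.Theorems.SunflowerPartition
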